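import Mathlib.Combinatorics.SimpleGraph.Coloring.Vertex
import Mathlib.Analysis.InnerProductSpace.PiL2
import HarnessLib

/-!
# Target (U) of the named-objects census: a 6-chromatic unit-distance graph in the plane

Framing (verbatim for the cell): lottery ticket; floor = certified bounds/negative ranges.

This file types the target and the two purely combinatorial REDUCTIONS that turn a census "hit" into the target.
Nothing here claims the target; the target is OPEN (de Grey 2018: `χ(ℝ²) ≥ 5`; upper bound 7).

* `IsUnitDistanceRealisation G p` — `p` embeds the vertices of `G` injectively in the Euclidean plane with adjacent
  vertices at distance exactly `1` (so `G` is a unit-distance graph; non-adjacent pairs are unconstrained).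
* `SixChromaticUnitDistanceGraphExists` — TARGET (U): some finite unit-distance graph is not 5-colourable.
* `not_colorable_of_forced_eq` — GLUING REDUCTION: if every proper `k`-colouring of `G₁` identifies the colours of
  `a₁, b₁`, likewise for `G₂` and `a₂, b₂`, and a host graph `H` receives homomorphic images of both with
  `a₁, a₂ ↦ x` and the images of `b₁, b₂` ADJACENT in `H`, then `H` is not `k`-colourable.  (Census probe `T2ne`:
  an UNSAT answer to "∃ 5-colouring with `c a ≠ c b`" in a unit-distance graph is exactly the hypothesis, with
  `G₂` a rotated copy of `G₁` about `a`; the host is their union, a unit-distance graph as soon as `|ab| ≥ 1/2`.)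
* `not_colorable_of_virtual_edges` — TEMPLATE REDUCTION: if `T₁ ≤ H`, every edge `(x,y)` of a second template
  graph `T₂` is covered by a homomorphic image of some graph all of whose `k`-colourings SEPARATE the two preimages
  (a "virtual edge"), and `T₁ ⊔ T₂` is not `k`-colourable, then `H` is not `k`-colourable.  (Census probe `T2eq`;
  the templates in print are the 6-chromatic two-distance graphs `{1,d}`, e.g. `d = 2` [Exoo–Ismailescu 2018,
  Parts 2020], `d = (1+√5)/2` [Huddleston; Parts 2020].)

Deliberately NOT here: any geometry of rotations/unions (the census certifies realisations numerically-exactly in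
`ℚ(√2,√3,√5,√11)` with two engines; a Lean realisation check is per-object, cf.
`Literature.Combinatorics.SimpleGraph.MoserMoser1961`), and de Bruijn–Erdős.
-/

namespace Summit.Ventures.DiscreteObjects.UnitDistance

open SimpleGraph

/-- `p : V → ℝ²` realises `G` as a unit-distance graph: `p` is injective and adjacent vertices are at Euclidean
distance exactly `1`.  (Non-edges are not required to avoid distance `1`: deleting edges of a unit-distance graph
keeps it a unit-distance graph, and only makes colouring easier.) -/
def IsUnitDistanceRealisation {V : Type*} (G : SimpleGraph V) (p : V → EuclideanSpace ℝ (Fin 2)) : Prop :=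
  Function.Injective p ∧ ∀ ⦃v w : V⦄, G.Adj v w → dist (p v) (p w) = 1

/-- TARGET (U) of the census (OPEN PROBLEM, not asserted): there is a finite unit-distance graph in the plane that is
not 5-colourable, i.e. a 6-chromatic unit-distance graph; it would give `χ(ℝ²) ≥ 6`.  Known: 5-chromatic ones exist
(de Grey 2018, 1581 vertices; Heule 2018/2019, 553/529/510; Parts 2020, 509); any 6-chromatic one has `≥ 42` vertices
and `≥ 182` edges (de Grey–Parts 2022). -/
def SixChromaticUnitDistanceGraphExists : Prop :=
  ∃ (n : ℕ) (G : SimpleGraph (Fin n)) (p : Fin n → EuclideanSpace ℝ (Fin 2)),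
    IsUnitDistanceRealisation G p ∧ ¬ G.Colorable 5

/-- A proper colouring of `H` pulls back along a graph homomorphism `f : G →g H` to a proper colouring of `G`. -/
def Coloring.pullback {V W : Type*} {G : SimpleGraph V} {H : SimpleGraph W} {α : Type*}
    (f : G →g H) (C : H.Coloring α) : G.Coloring α :=
  SimpleGraph.Coloring.mk (fun v => C (f v)) fun {_ _} h => C.valid (f.map_adj h)

/-- The pulled-back colouring is `C ∘ f`. -/
@[simp] lemma Coloring.pullback_apply {V W : Type*} {G : SimpleGraph V} {H : SimpleGraph W} {α : Type*}
    (f : G →g H) (C : H.Coloring α) (v : V) : Coloring.pullback f C v = C (f v) := rfl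

/-- GLUING REDUCTION (census probe `T2ne`).  Suppose every proper `k`-colouring of `G₁` gives `a₁` and `b₁` the same
colour, every proper `k`-colouring of `G₂` gives `a₂` and `b₂` the same colour, and `H` contains homomorphic images
`f₁ G₁`, `f₂ G₂` with `f₁ a₁ = f₂ a₂` and `f₁ b₁` adjacent to `f₂ b₂`.  Then `H` has no proper `k`-colouring. -/
theorem not_colorable_of_forced_eq {V₁ V₂ W : Type*} {G₁ : SimpleGraph V₁} {G₂ : SimpleGraph V₂}
    {H : SimpleGraph W} {k : ℕ} {a₁ b₁ : V₁} {a₂ b₂ : V₂}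
    (h₁ : ∀ C : G₁.Coloring (Fin k), C a₁ = C b₁) (h₂ : ∀ C : G₂.Coloring (Fin k), C a₂ = C b₂)
    (f₁ : G₁ →g H) (f₂ : G₂ →g H) (hx : f₁ a₁ = f₂ a₂) (hadj : H.Adj (f₁ b₁) (f₂ b₂)) :
    ¬ H.Colorable k := by
  rintro ⟨C⟩
  have e₁ := h₁ (Coloring.pullback f₁ C)
  have e₂ := h₂ (Coloring.pullback f₂ C)
  simp only [Coloring.pullback_apply] at e₁ e₂
  exact C.valid hadj (by rw [← e₁, ← e₂, hx])

/-- TEMPLATE REDUCTION (census probe `T2eq`, "virtual edges").  Let `T₁, T₂` be two graphs on the vertex set of `H`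
with `T₁ ≤ H`, such that every edge `x ~ y` of `T₂` is a VIRTUAL EDGE of `H` for `k` colours: there is a graph `G`,
a homomorphism `f : G →g H` and vertices `a, b` with `f a = x`, `f b = y` such that every proper `k`-colouring of `G`
separates `a` and `b`.  If `T₁ ⊔ T₂` is not `k`-colourable then neither is `H`. -/
theorem not_colorable_of_virtual_edges {W : Type*} {H T₁ T₂ : SimpleGraph W} {k : ℕ} (hT₁ : T₁ ≤ H)
    (hT₂ : ∀ ⦃x y : W⦄, T₂.Adj x y →
      ∃ (V : Type) (G : SimpleGraph V) (f : G →g H) (a b : V),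
        f a = x ∧ f b = y ∧ ∀ C : G.Coloring (Fin k), C a ≠ C b)
    (hT : ¬ (T₁ ⊔ T₂).Colorable k) : ¬ H.Colorable k := by
  rintro ⟨C⟩
  refine hT ⟨SimpleGraph.Coloring.mk C ?_⟩
  intro x y hxy
  rcases hxy with h | h
  · exact C.valid (hT₁ h)
  · obtain ⟨V, G, f, a, b, rfl, rfl, hsep⟩ := hT₂ h
    simpa only [Coloring.pullback_apply] using hsep (Coloring.pullback f C)

/-- How a census HIT of type `T2ne` closes the target: a unit-distance graph `H` (realised by `p`) that is shown
non-5-colourable by `not_colorable_of_forced_eq` (or by any other means) witnesses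
`SixChromaticUnitDistanceGraphExists`. -/
theorem sixChromatic_of_witness {n : ℕ} {H : SimpleGraph (Fin n)} {p : Fin n → EuclideanSpace ℝ (Fin 2)}
    (hp : IsUnitDistanceRealisation H p) (hH : ¬ H.Colorable 5) : SixChromaticUnitDistanceGraphExists :=
  ⟨n, H, p, hp, hH⟩

end Summit.Ventures.DiscreteObjects.UnitDistance

namespace Summit.Ventures.DiscreteObjects.UnitDistance

open SimpleGraph

/-- The unit-distance graph of the Euclidean plane: `x ~ y` iff `dist x y = 1`.  Its chromatic number is the
chromatic number of the plane (Hadwiger–Nelson); known `5 ≤ χ ≤ 7`. -/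
def planeUnitDistanceGraph : SimpleGraph (EuclideanSpace ℝ (Fin 2)) where
  Adj x y := dist x y = 1
  symm := ⟨fun x y h => by rw [dist_comm]; exact h⟩
  loopless := ⟨fun x h => by simp at h⟩

/-- A unit-distance realisation `p` of `G` is a graph homomorphism `G →g planeUnitDistanceGraph`. -/
noncomputable def IsUnitDistanceRealisation.toHom {V : Type*} {G : SimpleGraph V} {p : V → EuclideanSpace ℝ (Fin 2)}
    (hp : IsUnitDistanceRealisation G p) : G →g planeUnitDistanceGraph where
  toFun := p
  map_rel' h := hp.2 h

/-- If `G` has a unit-distance realisation and is not `k`-colourable, then the plane is not `k`-colourable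
(the easy direction of de Bruijn–Erdős: restrict a colouring of the plane to the realised vertices). -/
theorem not_colorable_plane_of_realisation {V : Type*} {G : SimpleGraph V} {p : V → EuclideanSpace ℝ (Fin 2)}
    {k : ℕ} (hp : IsUnitDistanceRealisation G p) (hG : ¬ G.Colorable k) : ¬ planeUnitDistanceGraph.Colorable k :=
  fun h => hG (h.of_hom hp.toHom)

/-- TARGET (U) ⇒ `χ(ℝ²) ≥ 6`: a 6-chromatic unit-distance graph makes the plane non-5-colourable, i.e. the chromatic
number of `planeUnitDistanceGraph` is at least `6`. -/
theorem six_le_chromaticNumber_plane (h : SixChromaticUnitDistanceGraphExists) :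
    6 ≤ planeUnitDistanceGraph.chromaticNumber := by
  obtain ⟨n, G, p, hp, hG⟩ := h
  have h5 : ¬ planeUnitDistanceGraph.Colorable 5 := not_colorable_plane_of_realisation hp hG
  refine le_chromaticNumber_iff_colorable.2 fun m hm => ?_
  by_contra hlt
  have hm5 : m ≤ 5 := by
    by_contra h'
    exact hlt (by exact_mod_cast (show 6 ≤ m by omega))
  exact h5 (hm.mono hm5)

end Summit.Ventures.DiscreteObjects.UnitDistance

namespace Summit.Ventures.DiscreteObjects.UnitDistance

open SimpleGraph

/-!
## Stage 0 of the census: removable blocks carry no colour constraint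

Elementary no-go lemmas that PRUNE the probe census (session 2 of the U seat).  If `G` minus an independent set `s` is
`k`-colourable, then `G` has a proper `(k+1)`-colouring in which `s` is exactly the class of the extra colour.  Hence
(`k = 4`, five colours): a pair `(a, b)` can be FORCED EQUAL (hypothesis of `not_colorable_of_forced_eq`, probe `T2ne`)
only if both `G - a` and `G - b` are still non-4-colourable, and can be a VIRTUAL EDGE (hypothesis of
`not_colorable_of_virtual_edges`, probe `T2eq`) only if `G - {a, b}` is non-4-colourable; an independent set `s` can be a
virtual hyperedge ("never monochromatic") only if `G - s` is non-4-colourable.  So one cheap 4-colouring call on `G - s`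
decides a whole family of 5-colour probes at once (this is also the printed remedy for the hard 64513-vertex instance:
Voronov–Neopryatnaya–Dergachev, Discrete Math. 345 (2022) 113106, §8 — colour the origin `5`, 4-colour the rest).
-/

section StageZero

variable {V : Type*} {G : SimpleGraph V} {k : ℕ}

/-- STAGE-0 LEMMA.  If `s` is independent and `G` minus `s` (the subgraph induced on `sᶜ`) is `k`-colourable, then `G`
has a proper `(k+1)`-colouring in which every vertex of `s` gets the colour `Fin.last k` and no other vertex does
(`s` is exactly one colour class).  In particular `s` is not a "virtual hyperedge" for `k+1` colours. -/
theorem exists_coloring_monochromatic_of_indep {s : Set V} (hs : G.IsIndepSet s)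
    (hc : (G.induce sᶜ).Colorable k) :
    ∃ C : G.Coloring (Fin (k + 1)), (∀ v ∈ s, C v = Fin.last k) ∧ ∀ v ∉ s, C v ≠ Fin.last k := by
  classical
  obtain ⟨C⟩ := hc
  let f : V → Fin (k + 1) := fun v => if h : v ∈ s then Fin.last k else Fin.castSucc (C ⟨v, h⟩)
  have hf_mem : ∀ v ∈ s, f v = Fin.last k := fun v hv => by simp only [f, dif_pos hv]
  have hf_nmem : ∀ v, ∀ hv : v ∉ s, f v = Fin.castSucc (C ⟨v, hv⟩) := fun v hv => by simp only [f, dif_neg hv]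
  refine ⟨Coloring.mk f ?_, hf_mem, fun v hv => ?_⟩
  · intro v w hvw
    by_cases hv : v ∈ s <;> by_cases hw : w ∈ s
    · exact absurd hvw (hs hv hw (G.ne_of_adj hvw))
    · rw [hf_mem v hv, hf_nmem w hw]; exact (Fin.castSucc_lt_last _).ne'
    · rw [hf_nmem v hv, hf_mem w hw]; exact (Fin.castSucc_lt_last _).ne
    · rw [hf_nmem v hv, hf_nmem w hw]
      intro h
      have hadj : (G.induce sᶜ).Adj ⟨v, hv⟩ ⟨w, hw⟩ := hvw
      exact C.valid hadj (Fin.castSucc_injective _ h)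
  · show f v ≠ Fin.last k
    rw [hf_nmem v hv]; exact (Fin.castSucc_lt_last _).ne

/-- Stage 0 for the probe `T2ne` (forced-equal pairs): if `G - a` is `k`-colourable then for every `b ≠ a` some proper
`(k+1)`-colouring SEPARATES `a` and `b` — give `a` a private colour. -/
theorem exists_coloring_ne_of_colorable_delete {a b : V} (hab : a ≠ b)
    (hc : (G.induce ({a} : Set V)ᶜ).Colorable k) : ∃ C : G.Coloring (Fin (k + 1)), C a ≠ C b := by
  obtain ⟨C, hCa, hCb⟩ := exists_coloring_monochromatic_of_indep (Set.pairwise_singleton a _) hc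
  exact ⟨C, fun h => hCb b (by simpa using hab.symm) (h.symm.trans (hCa a rfl))⟩

/-- Stage 0 for the probe `T2eq` (virtual edges): if `a, b` are non-adjacent and `G - {a, b}` is `k`-colourable then
some proper `(k+1)`-colouring IDENTIFIES the colours of `a` and `b` — give both the private colour. -/
theorem exists_coloring_eq_of_colorable_delete_pair {a b : V} (hab : ¬ G.Adj a b)
    (hc : (G.induce ({a, b} : Set V)ᶜ).Colorable k) : ∃ C : G.Coloring (Fin (k + 1)), C a = C b := by
  have hs : G.IsIndepSet ({a, b} : Set V) := by
    intro x hx y hy hxy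
    simp only [Set.mem_insert_iff, Set.mem_singleton_iff] at hx hy
    rcases hx with rfl | rfl <;> rcases hy with rfl | rfl
    · exact absurd rfl hxy
    · exact hab
    · exact fun h => hab h.symm
    · exact absurd rfl hxy
  obtain ⟨C, hC, -⟩ := exists_coloring_monochromatic_of_indep hs hc
  exact ⟨C, (hC a (by simp)).trans (hC b (by simp)).symm⟩

/-- CENSUS CONSEQUENCE (contrapositive of `exists_coloring_ne_of_colorable_delete`): a forced-equal pair `(a, b)` for
`k+1` colours — the hypothesis `h₁`/`h₂` of `not_colorable_of_forced_eq` — forces BOTH vertex-deleted graphs `G - a`,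
`G - b` to be non-`k`-colourable.  (For the target: a 5-colour forced pair lives only in a graph that stays 5-chromatic
after deleting either endpoint; vertex-critical 5-chromatic graphs have none.) -/
theorem not_colorable_delete_of_forced_eq {a b : V} (hab : a ≠ b)
    (h : ∀ C : G.Coloring (Fin (k + 1)), C a = C b) :
    ¬ (G.induce ({a} : Set V)ᶜ).Colorable k ∧ ¬ (G.induce ({b} : Set V)ᶜ).Colorable k :=
  ⟨fun hc => (exists_coloring_ne_of_colorable_delete hab hc).elim fun C hC => hC (h C),
   fun hc => (exists_coloring_ne_of_colorable_delete hab.symm hc).elim fun C hC => hC (h C).symm⟩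

/-- CENSUS CONSEQUENCE (contrapositive of `exists_coloring_eq_of_colorable_delete_pair`): a virtual edge `(a, b)` for
`k+1` colours between non-adjacent vertices — the hypothesis inside `not_colorable_of_virtual_edges` — forces
`G - {a, b}` to be non-`k`-colourable. -/
theorem not_colorable_delete_pair_of_virtual_edge {a b : V} (hab : ¬ G.Adj a b)
    (h : ∀ C : G.Coloring (Fin (k + 1)), C a ≠ C b) : ¬ (G.induce ({a, b} : Set V)ᶜ).Colorable k :=
  fun hc => (exists_coloring_eq_of_colorable_delete_pair hab hc).elim fun C hC => h C hC

/-- CENSUS CONSEQUENCE (hyperedge form): if every proper `(k+1)`-colouring of `G` makes the independent set `s`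
NON-monochromatic (a "virtual hyperedge", de Grey's 2018 mechanism one colour up), then `G - s` is non-`k`-colourable. -/
theorem not_colorable_delete_of_virtual_hyperedge {s : Set V} (hs : G.IsIndepSet s)
    (h : ∀ C : G.Coloring (Fin (k + 1)), ∃ v ∈ s, ∃ w ∈ s, C v ≠ C w) : ¬ (G.induce sᶜ).Colorable k := by
  intro hc
  obtain ⟨C, hC, -⟩ := exists_coloring_monochromatic_of_indep hs hc
  obtain ⟨v, hv, w, hw, hne⟩ := h C
  exact hne ((hC v hv).trans (hC w hw).symm)

end StageZero

/-! ## The removable core (census job U2-C; seat pub-namedobj-udg-g2, appended by udg-g3)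

A vertex `v` is *removable* (for `k` colours) when `G - v` is `k`-colourable.  Every removable vertex lies in every vertex
set inducing a non-`k`-colourable subgraph: the removable vertices form a common core of all `(k+1)`-chromatic induced
subgraphs.  Elementary; used to read the Stage-0 census (removable origin / dumbbell centres) structurally. -/

/-- THE CORE.  If `G.induce s` is not `k`-colourable but `G - v` (= `G.induce {v}ᶜ`) is, then `v ∈ s`. -/
theorem mem_of_not_colorable_induce {V : Type*} {G : SimpleGraph V} {k : ℕ} {s : Set V}
    (hs : ¬ (G.induce s).Colorable k) {v : V} (hv : (G.induce ({v}ᶜ : Set V)).Colorable k) : v ∈ s := by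
  by_contra h
  have hle : s ≤ ({v}ᶜ : Set V) := fun w hw => by
    simp only [Set.mem_compl_iff, Set.mem_singleton_iff]
    rintro rfl
    exact h hw
  exact hs (SimpleGraph.Colorable.of_hom (SimpleGraph.induceHomOfLE G hle).toHom hv)

/-- Contrapositive packaging: a vertex outside some non-`k`-colourable induced subgraph is NOT removable. -/
theorem not_colorable_delete_of_not_mem {V : Type*} {G : SimpleGraph V} {k : ℕ} {s : Set V}
    (hs : ¬ (G.induce s).Colorable k) {v : V} (hv : v ∉ s) : ¬ (G.induce ({v}ᶜ : Set V)).Colorable k :=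
  fun h => hv (mem_of_not_colorable_induce hs h)

end Summit.Ventures.DiscreteObjects.UnitDistance
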